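import Summits.BirchSwinnertonDyer.BirchSwinnertonDyer.Theorems.ErratumRoadFiveNonSurjCornerAuxPrimeKummerDescent
import Literature.NumberTheory.EllipticCurves.SerreOpenImageNormalizerCaseProofs
import Literature.NumberTheory.GaloisRepresentations.CartanNormalizerCriterionGL2Fp
import HarnessLib

/-!
# Route `ErratumRoadFive` (rung K2), crux `NonSurjCorner` (item stmt-BirchSwinnertonDyer-19065), line `Lines/hybrid.lean`, r22 slot 6″:
# the NON-SURJECTIVE IRREDUCIBLE mod-`p` image has order PRIME TO `p` (step (L0)), and the Kummer exclusion on the corner (steps (L0) + (L2))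
# (cell `bsd-stepL`, seat `bsd-stepL-corner-p1` g18; `--supports stmt-BirchSwinnertonDyer-19065 --as helper`)

WHY THIS FILE. `…NonSurjCornerAuxPrimeKummerDescent` (this seat) proved road B's Kummer descent ∕ exclusion for a mod-`p` image of order prime to
`p`. This file supplies that hypothesis ON THE CORNER from the tree's Serre–Caraiani–Newton group theory: if `E[p]` is irreducible and `ρ̄_{E,p}` is
NOT onto, then `p ∤ |ρ̄_{E,p}(Γ_ℚ)|` — by Serre's Prop. 15 (`CaraianiNewton.not_dvd_card_or_ker_det_le`: an irreducible subgroup of `GL₂(𝔽_p)` has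
order prime to `p` or contains `SL₂(𝔽_p)`) and `det ∘ ρ̄ = χ̄_p` onto `𝔽_pˣ` (a subgroup containing `SL₂` with full determinant is everything). Hence
the corner's Kummer exclusion with the LITERAL corner hypotheses (`E[p]` irreducible, `ρ̄` not onto) — step (L2) of the discharge of r22's slot 6″
(`stub_cornerAuxPrimeSupply57`) is COMPLETE; step (L1) (the Frobenius pre-witness with non-zero trace) remains.
* §1 `NonSurjCorner.not_dvd_card_range_galoisRepTorsion_of_irr_of_not_surj`;
* §2 `AuxPrimeSupplyCorner.kummerExclusion_of_irr_of_not_surj` (= -w2 g5's `kummerExclusion` with `hsurj` ↦ `hirr`, `hns`).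

HONEST FRAMING: TWO THEOREMS (no definition, no named fact, no `sorry`); pure Galois∕group theory; nothing about any curve's BSD; 19065 NOT closed;
BSD is not advanced; T7.
References (locators only): [cite: Serre1972, §2.4 Prop. 15, §2.6] [cite: CaraianiNewton2023, Lemma 6.2.2 (proof), Lemma 7.1.1 (proof)] [cite: GrossLMS1991, §9].
-/

noncomputable section

set_option autoImplicit false
set_option linter.dupNamespace false -- `Summit.BirchSwinnertonDyer.BirchSwinnertonDyer` (summit = problem), tree-wide

open scoped Classical NumberField MatrixGroups Pointwise nonZeroDivisors
open WeierstrassCurve NumberField Field Matrix IsDedekindDomain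
open Literature.NumberTheory.GaloisRepresentations Literature.NumberTheory.EllipticCurves
open Literature.NumberTheory.NumberFields.RingClassField Literature.NumberTheory.QuadraticFields

namespace Summit.BirchSwinnertonDyer.BirchSwinnertonDyer.Theorems

/-! ### §1 A non-surjective irreducible mod-`p` image has order prime to `p` -/

/-- **`p ∤ |ρ̄_{E,p}(Γ_ℚ)|` when `E[p]` is irreducible and `ρ̄_{E,p}` is not onto.** In a frame `Φ : Aut(E[p]) ≅ GL₂(𝔽_p)` (`exists_frame_galoisRepTorsion_rat`)
the image `G` fixes no line (irreducibility, `not_le_eigenvectorStabilizer_of_hasIrreducibleModPGaloisRep`); by Serre's Prop. 15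
(`CaraianiNewton.not_dvd_card_or_ker_det_le`) either `p ∤ |G|` or `SL₂(𝔽_p) = ker det ≤ G`; in the latter case `G = GL₂(𝔽_p)` because `det` is onto
`𝔽_pˣ` on `G` (`exists_mem_map_range_det_eq`), contradicting non-surjectivity (`map_range_galoisRepTorsion_eq_top_iff`).
[cite: Serre1972, §2.4 Prop. 15] [cite: CaraianiNewton2023, Lemma 6.2.2 (proof)] -/
theorem NonSurjCorner.not_dvd_card_range_galoisRepTorsion_of_irr_of_not_surj (W : WeierstrassCurve ℚ) [W.IsElliptic]
    {p : ℕ} [Fact p.Prime] (hirr : W.HasIrreducibleModPGaloisRep p) (hns : ¬ W.HasSurjectiveModNGaloisRep p) :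
    ¬ p ∣ Nat.card (galoisRepTorsion W p).range := by
  obtain ⟨e, Φ, he, -, -, -, -⟩ := W.exists_frame_galoisRepTorsion_rat p
  set G : Subgroup (GL (Fin 2) (ZMod p)) := (galoisRepTorsion W p).range.map Φ.toMonoidHom with hG
  have hcard : Nat.card G = Nat.card (galoisRepTorsion W p).range :=
    (Nat.card_congr ((galoisRepTorsion W p).range.equivMapOfInjective Φ.toMonoidHom Φ.injective).toEquiv).symm
  have hirrG : ∀ (v : Fin 2 → ZMod p) (hv : v ≠ 0), ¬ G ≤ eigenvectorStabilizer v hv :=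
    fun v hv ↦ not_le_eigenvectorStabilizer_of_hasIrreducibleModPGaloisRep W p Φ e he hirr hv
  rw [← hcard]
  rcases CaraianiNewton.not_dvd_card_or_ker_det_le G hirrG with h | hSL
  · exact h
  · exfalso
    refine hns ((map_range_galoisRepTorsion_eq_top_iff W p Φ).mp ?_)
    rw [eq_top_iff]
    intro M _
    obtain ⟨g, hgG, hg⟩ := exists_mem_map_range_det_eq W p Φ e he (Matrix.GeneralLinearGroup.det M)
    have hk : M * g⁻¹ ∈ G := hSL (by rw [MonoidHom.mem_ker, map_mul, map_inv, hg, mul_inv_cancel])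
    have hM : M * g⁻¹ * g ∈ G := G.mul_mem hk hgG
    rwa [inv_mul_cancel_right] at hM

/-! ### §2 The Kummer exclusion on the corner (literal corner hypotheses) -/

namespace AuxPrimeSupplyCorner

/-- **KUMMER EXCLUSION at a non-surjective irreducible image** — -w2 g5's `AuxPrimeSupply.kummerExclusion` with `ρ̄_{E,p}` onto replaced by «`E[p]`
irreducible and `ρ̄_{E,p}` NOT onto» (the (T4′) corner): for the split-prime Kummer witness `γ = β ∕ γ₀(β)`, no `p`-th root of `e(γ)` is fixed by
`res Γ_K ∩ Stab ζ_{p^E} ∩ ker ρ̄`. = `AuxPrimeSupply.kummerExclusion_of_not_dvd_card` ∘ §1. [cite: GrossLMS1991, §9] [cite: Serre1972, §2.4 Prop. 15] -/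
theorem kummerExclusion_of_irr_of_not_surj (W : WeierstrassCurve ℚ) [W.IsElliptic] {K : Type} [Field K] [NumberField K]
    (hK2 : Module.finrank ℚ K = 2) {p : ℕ} [Fact p.Prime] (hp5 : 5 ≤ p)
    (hirr : W.HasIrreducibleModPGaloisRep p) (hns : ¬ W.HasSurjectiveModNGaloisRep p) {E : ℕ} [NeZero (p ^ E)] (hE : 1 ≤ E)
    {ζ : AlgebraicClosure ℚ} (hζ : IsPrimitiveRoot ζ (p ^ E)) (e : K →ₐ[ℚ] AlgebraicClosure ℚ)
    (he : ∀ g : absoluteGaloisGroup ℚ, g ∈ (absGaloisRestrict ℚ K).range ↔ ∀ k : K, g • e k = e k)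
    {γ₀ : absoluteGaloisGroup ℚ} (hγ₀ : γ₀ ∉ (absGaloisRestrict ℚ K).range)
    {q : ℕ} (hq : q.Prime) {v v' : HeightOneSpectrum (𝓞 K)} (hvv' : v ≠ v')
    (hfac : Ideal.span {(q : 𝓞 K)} = v.asIdeal * v'.asIdeal) {h : ℕ} (hh0 : 0 < h)
    (hord : ∀ n : ℕ, ClassGroup.mk0 ⟨v.asIdeal, mem_nonZeroDivisors_iff_ne_zero.mpr v.ne_bot⟩ ^ n = 1 →
      h ∣ n)
    {β : 𝓞 K} (hβ : v.asIdeal ^ h = Ideal.span {β}) :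
    ∀ y : AlgebraicClosure ℚ, y ^ p = e (β : K) * (γ₀ • e (β : K))⁻¹ →
      ∃ a : absoluteGaloisGroup ℚ, a ∈ (absGaloisRestrict ℚ K).range ∧ a • ζ = ζ ∧
        galoisRepTorsion W p a = 1 ∧ a • y ≠ y :=
  AuxPrimeSupply.kummerExclusion_of_not_dvd_card W hK2 hp5
    (NonSurjCorner.not_dvd_card_range_galoisRepTorsion_of_irr_of_not_surj W hirr hns) hE hζ e he hγ₀ hq hvv' hfac hh0 hord hβ

end AuxPrimeSupplyCorner

end Summit.BirchSwinnertonDyer.BirchSwinnertonDyer.Theorems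

end
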